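import Summits.KontsevichZagierPeriods.Zeta5Search.Barrier.ConeGammaPhiDigammaCert

/-!
# ζ(5) search — BARRIER: MERGING the gaps of a table into blocks of equal value (digamma only at the JUMP points)

HONEST FRAMING (cell `pub-zeta5`): systematic search; no irrationality claim unless kernel-certified. MODEL objects
under Brown–Zudilin's (28)+(30) accounting ([BZ22] = arXiv:2210.03391); nothing here is a statement about `ζ(5)`;
records in print UNMOVED. Sequel of `ConeGammaPhiDigammaCert` (seat P2 g13). The exact period formula
`Φ(a) = Σ_{1 ≤ m < M} c_m·(ψ(b_{m+1}) − ψ(b_m))` runs over ALL gaps of the floor arrangement (`M = 2 750` at the ridge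
direction `t*`), but consecutive gaps with the same value telescope: only the JUMP points of `N_a` need a digamma value
(`1 475` at `t*`). Pure algebra on top of the certified fine table — no new analysis:

* `psiAt gs k = Re ψ(b_k)`; `blockSum gs p js e` — the telescoped sum over the blocks `[p, j₁), [j₁, j₂), …, [j_last, e)`;
  `blocksOK gs p js e` — the kernel test that the block starts increase and `c` is constant on every block;
  **`bandSum_eq_blockSum`** — then `Σ_{p ≤ m < e} c_m(ψ(b_{m+1}) − ψ(b_m)) = blockSum gs p js e`;
* `blockAcc` / `blockBandCheck S Kpi K J gs p js e LB UB` — ONE interval pass over a band of blocks (each `ψ(b_j)` once;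
  reduction depth = number of blocks in the band) and **`bandSum_mem_of_blockBandCheck`**: `LB/S ≤ bandSum gs p e ≤ UB/S`;
* `BandClaims` / **`bandSum_mem_of_bandClaims`** — gluing consecutive bands `[p₁,e₁), [e₁,e₂), …` into one enclosure, and
  **`phi30_mem_of_bandClaims`** — with a passed `gapsCheck`: `Φ(a) ∈ [ΣLB/S, ΣUB/S]`.
-/

noncomputable section

namespace Summit.KontsevichZagierPeriods.Zeta5Search.Barrier.ConeGamma

open Finset Set
open Literature.Analysis.ValidatedNumerics.NumericsMP

/-! ### Blocks of equal value telescope -/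

/-- `Re ψ(b_k)` for the breakpoint `b_k` of a table. -/
def psiAt (gs : List GapRec) (k : ℕ) : ℝ := (Complex.digamma ((bpt gs k : ℝ) : ℂ)).re

/-- One term of the digamma sum is `c_m·(Ψ(m+1) − Ψ(m))`. -/
theorem phiTerm_eq (gs : List GapRec) (m : ℕ) : phiTerm gs m = (cval gs m : ℝ) * (psiAt gs (m + 1) - psiAt gs m) := by
  simp [phiTerm, psiAt, Complex.sub_re]

/-- A band on which `c` is constant telescopes: `Σ_{p ≤ m < q} c_m(Ψ(m+1) − Ψ(m)) = c_p·(Ψ q − Ψ p)`. -/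
theorem bandSum_const (gs : List GapRec) {p q : ℕ} (hpq : p ≤ q) (hc : ∀ m, p ≤ m → m < q → cval gs m = cval gs p) :
    bandSum gs p q = (cval gs p : ℝ) * (psiAt gs q - psiAt gs p) := by
  unfold bandSum
  have h1 : ∑ m ∈ Finset.Ico p q, phiTerm gs m = ∑ m ∈ Finset.Ico p q, (cval gs p : ℝ) * (psiAt gs (m + 1) - psiAt gs m) := by
    refine Finset.sum_congr rfl fun m hm => ?_
    rw [Finset.mem_Ico] at hm
    rw [phiTerm_eq, hc m hm.1 hm.2]
  rw [h1, ← Finset.mul_sum, Finset.sum_Ico_eq_sum_range]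
  have htel : ∑ k ∈ Finset.range (q - p), (psiAt gs (p + k + 1) - psiAt gs (p + k)) = psiAt gs q - psiAt gs p := by
    have := Finset.sum_range_sub (fun k => psiAt gs (p + k)) (q - p)
    simp only [add_zero] at this
    rw [show p + (q - p) = q by omega] at this
    rw [← this]
    refine Finset.sum_congr rfl fun k _ => by ring_nf
  rw [htel]

/-- The telescoped sum over the blocks `[p, j₁), [j₁, j₂), …, [j_last, e)` (block starts `js`, end `e`). -/
def blockSum (gs : List GapRec) : ℕ → List ℕ → ℕ → ℝ
  | p, [], e => (cval gs p : ℝ) * (psiAt gs e - psiAt gs p)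
  | p, j :: js, e => (cval gs p : ℝ) * (psiAt gs j - psiAt gs p) + blockSum gs j js e

/-- Kernel test of a block structure: starts increase up to `e` and `c` is constant on every block. -/
def blocksOK (gs : List GapRec) : ℕ → List ℕ → ℕ → Bool
  | p, [], e => decide (p ≤ e) && (List.range (e - p)).all fun i => decide (cval gs (p + i) = cval gs p)
  | p, j :: js, e => decide (p ≤ j) && ((List.range (j - p)).all fun i => decide (cval gs (p + i) = cval gs p)) &&
      blocksOK gs j js e

/-- What the constancy part of the test says. -/
theorem const_of_all {gs : List GapRec} {p q : ℕ}
    (h : ((List.range (q - p)).all fun i => decide (cval gs (p + i) = cval gs p)) = true) :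
    ∀ m, p ≤ m → m < q → cval gs m = cval gs p := by
  intro m hpm hmq
  rw [List.all_eq_true] at h
  have := h (m - p) (List.mem_range.2 (by omega))
  rw [decide_eq_true_eq, show p + (m - p) = m by omega] at this
  exact this

/-- A passed block test ends at or after its start. -/
theorem le_of_blocksOK {gs : List GapRec} : ∀ (p : ℕ) (js : List ℕ) (e : ℕ), blocksOK gs p js e = true → p ≤ e := by
  intro p js
  induction js generalizing p with
  | nil => intro e h; simp only [blocksOK, Bool.and_eq_true, decide_eq_true_eq] at h; exact h.1
  | cons j js ih =>
    intro e h
    simp only [blocksOK, Bool.and_eq_true, decide_eq_true_eq] at h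
    exact h.1.1.trans (ih j e h.2)

/-- **Merging**: on a passed block structure the fine digamma band sum IS the telescoped block sum. -/
theorem bandSum_eq_blockSum {gs : List GapRec} : ∀ (p : ℕ) (js : List ℕ) (e : ℕ), blocksOK gs p js e = true →
    bandSum gs p e = blockSum gs p js e := by
  intro p js
  induction js generalizing p with
  | nil =>
    intro e h
    simp only [blocksOK, Bool.and_eq_true, decide_eq_true_eq] at h
    exact bandSum_const gs h.1 (const_of_all h.2)
  | cons j js ih =>
    intro e h
    simp only [blocksOK, Bool.and_eq_true, decide_eq_true_eq] at h
    obtain ⟨⟨hpj, hconst⟩, hrest⟩ := h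
    have hje : j ≤ e := le_of_blocksOK j js e hrest
    rw [blockSum, ← bandSum_add gs hpj hje, bandSum_const gs hpj (const_of_all hconst), ih j e hrest]

/-! ### One interval pass over a band of blocks -/

/-- Accumulator over the blocks of a band: state `(box of the partial block sum, box of ψ(b_p))` at the current start `p`;
each jump point's `ψ` is evaluated once; reduction depth = number of blocks. -/
def blockAcc (S K J : ℕ) (P : MI) (gs : List GapRec) : MI → MI → ℕ → List ℕ → ℕ → Option MI
  | A, X, p, [], e =>
    match psiBox S K J P (bptND gs e).1 (bptND gs e).2 with
    | some Y => some (A.add ((Y.sub X).mulInt (cval gs p)))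
    | none => none
  | A, X, p, j :: js, e =>
    match psiBox S K J P (bptND gs j).1 (bptND gs j).2 with
    | some Y => blockAcc S K J P gs (A.add ((Y.sub X).mulInt (cval gs p))) Y j js e
    | none => none

/-- **Invariant of the block pass**: if `A ∋ t` and `X ∋ Re ψ(b_p)` then the result contains `t + blockSum gs p js e`. -/
theorem mem_blockAcc {S : ℕ} (hS : 0 < S) {K J : ℕ} {P : MI} (hP : MI.mem S Real.pi P) (gs : List GapRec) :
    ∀ (js : List ℕ) (A X : MI) (p e : ℕ) (t : ℝ) (R : MI), MI.mem S t A → MI.mem S (psiAt gs p) X →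
      blockAcc S K J P gs A X p js e = some R → MI.mem S (t + blockSum gs p js e) R := by
  intro js
  induction js with
  | nil =>
    intro A X p e t R hA hX h
    simp only [blockAcc] at h
    split at h
    · rename_i Y hY
      simp only [Option.some.injEq] at h
      subst h
      have hY' : MI.mem S (psiAt gs e) Y := by rw [psiAt, bpt_eq_bptND]; exact mem_psiBox hS hP hY
      have := MI.mem_add hA (MI.mem_mulInt (MI.mem_sub hY' hX) (cval gs p))
      simpa [blockSum, mul_comm] using this
    · simp at h
  | cons j js ih =>
    intro A X p e t R hA hX h
    simp only [blockAcc] at h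
    split at h
    · rename_i Y hY
      have hY' : MI.mem S (psiAt gs j) Y := by rw [psiAt, bpt_eq_bptND]; exact mem_psiBox hS hP hY
      have hA' := MI.mem_add hA (MI.mem_mulInt (MI.mem_sub hY' hX) (cval gs p))
      have := ih _ Y j e _ R hA' hY' h
      simp only [blockSum]
      convert this using 1
      ring
    · simp at h

/-- **Block-band test**: the box of the band `Σ_{p ≤ m < e}` (computed over its blocks `js`) inside `[LB, UB]` (scaled integers),
after checking the block structure. -/
def blockBandCheck (S Kpi K J : ℕ) (gs : List GapRec) (p : ℕ) (js : List ℕ) (e : ℕ) (LB UB : ℤ) : Bool :=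
  blocksOK gs p js e &&
    match MI.piMachin S Kpi with
    | some P =>
      match psiBox S K J P (bptND gs p).1 (bptND gs p).2 with
      | some X =>
        match blockAcc S K J P gs (MI.ofInt S 0) X p js e with
        | some R => decide (LB ≤ R.lo) && decide (R.hi ≤ UB)
        | none => false
      | none => false
    | none => false

/-- **Soundness of `blockBandCheck`**: `LB/S ≤ Σ_{p ≤ m < e} c_m(ψ(b_{m+1}) − ψ(b_m)) ≤ UB/S`. -/
theorem bandSum_mem_of_blockBandCheck {S : ℕ} (hS : 0 < S) {Kpi K J : ℕ} {gs : List GapRec} {p e : ℕ} {js : List ℕ}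
    {LB UB : ℤ} (h : blockBandCheck S Kpi K J gs p js e LB UB = true) :
    (LB : ℝ) / S ≤ bandSum gs p e ∧ bandSum gs p e ≤ (UB : ℝ) / S := by
  unfold blockBandCheck at h
  simp only [Bool.and_eq_true] at h
  obtain ⟨hblocks, h⟩ := h
  split at h
  · rename_i P hP
    split at h
    · rename_i X hX
      split at h
      · rename_i R hR
        simp only [Bool.and_eq_true, decide_eq_true_eq] at h
        obtain ⟨hlo, hhi⟩ := h
        have hpi := MI.mem_piMachin hS hP
        have hX' : MI.mem S (psiAt gs p) X := by rw [psiAt, bpt_eq_bptND]; exact mem_psiBox hS hpi hX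
        have h0 : MI.mem S (0 : ℝ) (MI.ofInt S 0) := by simpa using MI.mem_ofInt S 0
        obtain ⟨h1, h2⟩ := mem_blockAcc hS hpi gs js _ X p e 0 R h0 hX' hR
        rw [zero_add, ← bandSum_eq_blockSum p js e hblocks] at h1 h2
        have hSr : (0 : ℝ) < S := by exact_mod_cast hS
        have hlo' : (LB : ℝ) ≤ R.lo := by exact_mod_cast hlo
        have hhi' : (R.hi : ℝ) ≤ UB := by exact_mod_cast hhi
        constructor
        · rw [div_le_iff₀ hSr]; linarith
        · rw [le_div_iff₀ hSr]; linarith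
      · simp at h
    · simp at h
  · simp at h

/-! ### Gluing consecutive bands -/

/-- The claims of a list of bands `(p, e, LB, UB)`: each band sum lies in its window. -/
def BandClaims (S : ℕ) (gs : List GapRec) : List (ℕ × ℕ × ℤ × ℤ) → Prop
  | [] => True
  | (p, e, LB, UB) :: rest => ((LB : ℝ) / S ≤ bandSum gs p e ∧ bandSum gs p e ≤ (UB : ℝ) / S) ∧ BandClaims S gs rest

/-- Kernel test that the bands are consecutive: `p ≤ e` and each band starts where the previous one ends, the last at `E`. -/
def bandsConsec : ℕ → List (ℕ × ℕ × ℤ × ℤ) → ℕ → Bool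
  | p₀, [], E => decide (p₀ = E)
  | p₀, (p, e, _, _) :: rest, E => decide (p = p₀) && decide (p ≤ e) && bandsConsec e rest E

/-- Sum of the lower window ends. -/
def sumLB : List (ℕ × ℕ × ℤ × ℤ) → ℤ
  | [] => 0
  | (_, _, LB, _) :: rest => LB + sumLB rest

/-- Sum of the upper window ends. -/
def sumUB : List (ℕ × ℕ × ℤ × ℤ) → ℤ
  | [] => 0
  | (_, _, _, UB) :: rest => UB + sumUB rest

/-- **Gluing**: consecutive band claims from `p₀` to `E` enclose `Σ_{p₀ ≤ m < E}`. -/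
theorem bandSum_mem_of_bandClaims (S : ℕ) (gs : List GapRec) :
    ∀ (specs : List (ℕ × ℕ × ℤ × ℤ)) (p₀ E : ℕ), bandsConsec p₀ specs E = true → BandClaims S gs specs →
      (sumLB specs : ℝ) / S ≤ bandSum gs p₀ E ∧ bandSum gs p₀ E ≤ (sumUB specs : ℝ) / S ∧ p₀ ≤ E := by
  intro specs
  induction specs with
  | nil =>
    intro p₀ E hc _
    simp only [bandsConsec, decide_eq_true_eq] at hc
    subst hc
    simp [sumLB, sumUB, bandSum]
  | cons s rest ih =>
    intro p₀ E hc hcl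
    obtain ⟨p, e, LB, UB⟩ := s
    simp only [bandsConsec, Bool.and_eq_true, decide_eq_true_eq] at hc
    obtain ⟨⟨hp, hpe⟩, hrest⟩ := hc
    subst hp
    obtain ⟨⟨h1, h2⟩, hcl'⟩ := hcl
    obtain ⟨i1, i2, heE⟩ := ih e E hrest hcl'
    rw [← bandSum_add gs hpe heE]
    simp only [sumLB, sumUB, Int.cast_add, add_div]
    exact ⟨by linarith, by linarith, hpe.trans heE⟩

/-- **`Φ(a)` from a passed gap table and consecutive band claims covering `[1, M)`.** -/
theorem phi30_mem_of_bandClaims {a : Fin 8 → ℤ} {gs : List GapRec} (hg : gapsCheck a gs = true) (S : ℕ)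
    {specs : List (ℕ × ℕ × ℤ × ℤ)} (hc : bandsConsec 1 specs gs.length = true) (hcl : BandClaims S gs specs) :
    phi30 (realDir a) ∈ Icc ((sumLB specs : ℝ) / S) ((sumUB specs : ℝ) / S) := by
  obtain ⟨h1, h2, _⟩ := bandSum_mem_of_bandClaims S gs specs 1 gs.length hc hcl
  rw [phi30_eq_of_gapsCheck hg, ← phiSum, phiSum_eq_bandSum]
  exact ⟨h1, h2⟩

end Summit.KontsevichZagierPeriods.Zeta5Search.Barrier.ConeGamma

end
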